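import Literature.Probability.Percolation.QuadCrossingSquareModel
import Literature.Probability.RandomPlanarGeometry.PolygonalDomains
import HarnessLib

/-!
# The half-annulus quad `{0 ≤ im, 1 ≤ ‖·‖_∞ ≤ L}` as a conformal rectangle

Topic `Literature/Probability/Percolation`; proofs only (no definition, no named fact). The
half-annulus `A⁺(1, L) = {z : im z ≥ 0, 1 ≤ ‖z‖_∞ ≤ L}` with its four corners `-1, 1, L, -L` is
the quad whose Schramm–Smirnov crossing event (`quadCrossing`, `QuadCrossingRotationInvariance.lean`)
between the sides "inner half-square" and "outer half-square" is the block event of the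
half-plane one-arm quasi-multiplicativity (P. Nolin, EJP 13 (2008), §4.6: arm events
`B_{j,σ}(n, N)` between `∂S'_n = ∂S_n ∩ ℍ` and `∂S'_N`; here `j = 1`). We realise it as a
`ConformalRectangle` (a Jordan domain with four marked boundary points, `PlanarDomains.lean`)
WITHOUT introducing a definition: `exists_halfAnnulusQuad` states that for every `L > 1` there is
a conformal rectangle `R` with

* `closure R.carrier = {0 ≤ im, 1 ≤ max |re| |im| ≤ L}` (the closed half-annulus),
* `R.arc 0 = {0 ≤ im, max |re| |im| = 1}` (inner half-square) and
  `R.arc 2 = {0 ≤ im, max |re| |im| = L}` (outer half-square),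

namely the polygonal Jordan domain (`polygonDomain`, from the tree's Jordan curve theorem) of the
simple closed octagon `-1, -1+i, 1+i, 1, L, L+Li, -L+Li, -L` with the corners `-1, 1, L, -L` marked
(parameters `0, 3/8, 4/8, 7/8`), its carrier identified with the open half-annulus by
`polygonDomain_carrier_eq`. References: P. Nolin, EJP 13 (2008), §4.6 [Nolin2008]; O. Schramm,
S. Smirnov, Ann. Probab. 39 (2011), §1.3 [SchrammSmirnov2011].
-/

noncomputable section

namespace Literature.Probability.Percolation

open Set Complex
open Literature.Probability.RandomPlanarGeometry

namespace HalfPlaneArm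

local notation3 "sn[" w "]" => max |Complex.re w| |Complex.im w|
local notation3 "verts[" L "]" =>
  [(⟨-1, 0⟩ : ℂ), ⟨-1, 1⟩, ⟨1, 1⟩, ⟨1, 0⟩, ⟨L, 0⟩, ⟨L, L⟩, ⟨-L, L⟩, ⟨-L, 0⟩]
local notation3 "openHA[" L "]" =>
  {z : ℂ | 0 < z.im ∧ z.im < L ∧ -L < z.re ∧ z.re < L ∧ (1 < z.re ∨ z.re < -1 ∨ 1 < z.im)}
local notation3 "closedHA[" L "]" =>
  {z : ℂ | 0 ≤ z.im ∧ z.im ≤ L ∧ -L ≤ z.re ∧ z.re ≤ L ∧ (1 ≤ z.re ∨ z.re ≤ -1 ∨ 1 ≤ z.im)}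
/-! ### Axis-parallel segments -/

/-- A vertical segment in coordinates. [folklore] -/
theorem segment_vert {a b₁ b₂ : ℝ} (h : b₁ < b₂) :
    segment ℝ (⟨a, b₁⟩ : ℂ) ⟨a, b₂⟩ = {z : ℂ | z.re = a ∧ b₁ ≤ z.im ∧ z.im ≤ b₂} := by
  have e : ∀ θ : ℝ, (AffineMap.lineMap (⟨a, b₁⟩ : ℂ) (⟨a, b₂⟩ : ℂ) θ : ℂ) = ⟨a, b₁ + θ * (b₂ - b₁)⟩ :=
    fun θ => by apply Complex.ext <;> simp [AffineMap.lineMap_apply_module']; ring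
  ext z
  rw [segment_eq_image_lineMap]
  constructor
  · rintro ⟨θ, ⟨hθ0, hθ1⟩, rfl⟩
    rw [e]
    refine ⟨rfl, ?_, ?_⟩ <;> dsimp only <;> nlinarith
  · rintro ⟨hre, h1, h2⟩
    obtain ⟨θ, hθ0, hθ1, hθ⟩ : ∃ θ : ℝ, 0 ≤ θ ∧ θ ≤ 1 ∧ θ * (b₂ - b₁) = z.im - b₁ :=
      ⟨(z.im - b₁) / (b₂ - b₁), div_nonneg (by linarith) (by linarith),
        by rw [div_le_one (by linarith)]; linarith, div_mul_cancel₀ _ (by linarith)⟩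
    refine ⟨θ, ⟨hθ0, hθ1⟩, ?_⟩
    rw [e]
    apply Complex.ext
    · exact hre.symm
    · show b₁ + θ * (b₂ - b₁) = z.im
      linarith

/-- A horizontal segment in coordinates. [folklore] -/
theorem segment_horiz {a₁ a₂ b : ℝ} (h : a₁ < a₂) :
    segment ℝ (⟨a₁, b⟩ : ℂ) ⟨a₂, b⟩ = {z : ℂ | z.im = b ∧ a₁ ≤ z.re ∧ z.re ≤ a₂} := by
  have e : ∀ θ : ℝ, (AffineMap.lineMap (⟨a₁, b⟩ : ℂ) (⟨a₂, b⟩ : ℂ) θ : ℂ) = ⟨a₁ + θ * (a₂ - a₁), b⟩ :=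
    fun θ => by apply Complex.ext <;> simp [AffineMap.lineMap_apply_module']; ring
  ext z
  rw [segment_eq_image_lineMap]
  constructor
  · rintro ⟨θ, ⟨hθ0, hθ1⟩, rfl⟩
    rw [e]
    refine ⟨rfl, ?_, ?_⟩ <;> dsimp only <;> nlinarith
  · rintro ⟨him, h1, h2⟩
    obtain ⟨θ, hθ0, hθ1, hθ⟩ : ∃ θ : ℝ, 0 ≤ θ ∧ θ ≤ 1 ∧ θ * (a₂ - a₁) = z.re - a₁ :=
      ⟨(z.re - a₁) / (a₂ - a₁), div_nonneg (by linarith) (by linarith),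
        by rw [div_le_one (by linarith)]; linarith, div_mul_cancel₀ _ (by linarith)⟩
    refine ⟨θ, ⟨hθ0, hθ1⟩, ?_⟩
    rw [e]
    apply Complex.ext
    · show a₁ + θ * (a₂ - a₁) = z.re
      linarith
    · exact him.symm

/-! ### The octagon is a simple closed polygon -/

/-- The octagon `-1, -1+i, 1+i, 1, L, L+Li, -L+Li, -L` (`L > 1`) is a simple closed polygon.
[folklore] -/
theorem isSimpleClosedPolygon_verts {L : ℝ} (hL : 1 < L) : IsSimpleClosedPolygon verts[L] := by
  refine IsSimpleClosedPolygon.of_lt (by simp) ?_ ?_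
  · intro k hk
    have : k < 8 := by simpa using hk
    interval_cases k <;> simp [Complex.ext_iff] <;> intro h <;> linarith
  · intro i j hi hj hij
    have hj8 : j < 8 := by simpa using hj
    interval_cases j <;> interval_cases i <;>
    · simp only [List.length_cons, List.length_nil, Nat.reduceAdd, Nat.reduceMod,
        List.getElem_cons_zero, List.getElem_cons_succ, Set.disjoint_left]
      rintro _ ⟨θ, ⟨hθ0, hθ1⟩, rfl⟩ ⟨θ', ⟨hθ0', hθ1'⟩, h⟩
      have hre := congrArg Complex.re h
      have him := congrArg Complex.im h
      simp [AffineMap.lineMap_apply_module'] at hre him <;>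
        nlinarith [mul_pos (sub_pos.2 hθ1) (sub_pos.2 hL), mul_pos (sub_pos.2 hθ1') (sub_pos.2 hL),
          mul_nonneg hθ0 (sub_pos.2 hL).le, mul_nonneg hθ0' (sub_pos.2 hL).le]

/-! ### The eight sides -/

/-- **The boundary octagon in coordinates**: a point lies on the closed polygon through
`verts[L]` iff it lies on one of its eight axis-parallel sides. [folklore] -/
theorem mem_range_polygonLoop_verts_iff {L : ℝ} (hL : 1 < L) {z : ℂ} :
    z ∈ range (polygonLoop verts[L]) ↔
      (z.re = -1 ∧ 0 ≤ z.im ∧ z.im ≤ 1) ∨ (z.im = 1 ∧ -1 ≤ z.re ∧ z.re ≤ 1) ∨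
      (z.re = 1 ∧ 0 ≤ z.im ∧ z.im ≤ 1) ∨ (z.im = 0 ∧ 1 ≤ z.re ∧ z.re ≤ L) ∨
      (z.re = L ∧ 0 ≤ z.im ∧ z.im ≤ L) ∨ (z.im = L ∧ -L ≤ z.re ∧ z.re ≤ L) ∨
      (z.re = -L ∧ 0 ≤ z.im ∧ z.im ≤ L) ∨ (z.im = 0 ∧ -L ≤ z.re ∧ z.re ≤ -1) := by
  have hL0 : (0 : ℝ) < L := by linarith
  have s0 : segment ℝ (⟨-1, 0⟩ : ℂ) ⟨-1, 1⟩ = {z : ℂ | z.re = -1 ∧ 0 ≤ z.im ∧ z.im ≤ 1} :=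
    segment_vert one_pos
  have s1 : segment ℝ (⟨-1, 1⟩ : ℂ) ⟨1, 1⟩ = {z : ℂ | z.im = 1 ∧ -1 ≤ z.re ∧ z.re ≤ 1} :=
    segment_horiz (by norm_num)
  have s2 : segment ℝ (⟨1, 1⟩ : ℂ) ⟨1, 0⟩ = {z : ℂ | z.re = 1 ∧ 0 ≤ z.im ∧ z.im ≤ 1} := by
    rw [segment_symm]; exact segment_vert one_pos
  have s3 : segment ℝ (⟨1, 0⟩ : ℂ) ⟨L, 0⟩ = {z : ℂ | z.im = 0 ∧ 1 ≤ z.re ∧ z.re ≤ L} :=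
    segment_horiz hL
  have s4 : segment ℝ (⟨L, 0⟩ : ℂ) ⟨L, L⟩ = {z : ℂ | z.re = L ∧ 0 ≤ z.im ∧ z.im ≤ L} :=
    segment_vert hL0
  have s5 : segment ℝ (⟨L, L⟩ : ℂ) ⟨-L, L⟩ = {z : ℂ | z.im = L ∧ -L ≤ z.re ∧ z.re ≤ L} := by
    rw [segment_symm]; exact segment_horiz (by linarith)
  have s6 : segment ℝ (⟨-L, L⟩ : ℂ) ⟨-L, 0⟩ = {z : ℂ | z.re = -L ∧ 0 ≤ z.im ∧ z.im ≤ L} := by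
    rw [segment_symm]; exact segment_vert hL0
  have s7 : segment ℝ (⟨-L, 0⟩ : ℂ) ⟨-1, 0⟩ = {z : ℂ | z.im = 0 ∧ -L ≤ z.re ∧ z.re ≤ -1} :=
    segment_horiz (by linarith)
  rw [range_polygonLoop (by simp), mem_iUnion]
  constructor
  · rintro ⟨k, hk⟩
    fin_cases k <;>
      simp only [List.length_cons, List.length_nil, Nat.reduceAdd, Nat.reduceMod,
        List.getElem_cons_zero, List.getElem_cons_succ] at hk <;>
      first
      | (rw [s0] at hk; exact Or.inl hk)
      | (rw [s1] at hk; exact Or.inr (Or.inl hk))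
      | (rw [s2] at hk; exact Or.inr (Or.inr (Or.inl hk)))
      | (rw [s3] at hk; exact Or.inr (Or.inr (Or.inr (Or.inl hk))))
      | (rw [s4] at hk; exact Or.inr (Or.inr (Or.inr (Or.inr (Or.inl hk)))))
      | (rw [s5] at hk; exact Or.inr (Or.inr (Or.inr (Or.inr (Or.inr (Or.inl hk))))))
      | (rw [s6] at hk; exact Or.inr (Or.inr (Or.inr (Or.inr (Or.inr (Or.inr (Or.inl hk)))))))
      | (rw [s7] at hk; exact Or.inr (Or.inr (Or.inr (Or.inr (Or.inr (Or.inr (Or.inr hk)))))))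
  · rintro (h | h | h | h | h | h | h | h)
    · exact ⟨⟨0, by simp⟩, by simpa [s0] using h⟩
    · exact ⟨⟨1, by simp⟩, by simpa [s1] using h⟩
    · exact ⟨⟨2, by simp⟩, by simpa [s2] using h⟩
    · exact ⟨⟨3, by simp⟩, by simpa [s3] using h⟩
    · exact ⟨⟨4, by simp⟩, by simpa [s4] using h⟩
    · exact ⟨⟨5, by simp⟩, by simpa [s5] using h⟩
    · exact ⟨⟨6, by simp⟩, by simpa [s6] using h⟩
    · exact ⟨⟨7, by simp⟩, by simpa [s7] using h⟩

/-! ### The closed half-annulus and its two half-squares in coordinates -/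

/-- The closed half-annulus `{0 ≤ im, 1 ≤ ‖·‖_∞ ≤ L}` in linear coordinates. [folklore] -/
theorem mem_closedHA_iff {L : ℝ} {z : ℂ} :
    (0 ≤ z.im ∧ 1 ≤ sn[z] ∧ sn[z] ≤ L) ↔ z ∈ closedHA[L] := by
  simp only [mem_setOf_eq, le_max_iff, max_le_iff, abs_le, le_abs]
  constructor
  · rintro ⟨h0, h1, ⟨h2, h3⟩, h4, h5⟩
    refine ⟨h0, h5, h2, h3, ?_⟩
    rcases h1 with (h | h) | (h | h)
    · exact Or.inl h
    · exact Or.inr (Or.inl (by linarith))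
    · exact Or.inr (Or.inr h)
    · exfalso; linarith
  · rintro ⟨h0, h5, h2, h3, h1⟩
    refine ⟨h0, ?_, ⟨h2, h3⟩, by linarith, h5⟩
    rcases h1 with h | h | h
    · exact Or.inl (Or.inl h)
    · exact Or.inl (Or.inr (by linarith))
    · exact Or.inr (Or.inl h)

/-- The inner half-square `{0 ≤ im, ‖·‖_∞ = 1}` in linear coordinates. [folklore] -/
theorem mem_inner_iff {z : ℂ} : (0 ≤ z.im ∧ sn[z] = 1) ↔
    (z.re = -1 ∧ 0 ≤ z.im ∧ z.im ≤ 1) ∨ (z.im = 1 ∧ -1 ≤ z.re ∧ z.re ≤ 1) ∨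
      (z.re = 1 ∧ 0 ≤ z.im ∧ z.im ≤ 1) := by
  constructor
  · rintro ⟨h0, h1⟩
    have hre : |z.re| ≤ 1 := h1 ▸ le_max_left _ _
    have him : |z.im| ≤ 1 := h1 ▸ le_max_right _ _
    rw [abs_le] at hre him
    rcases max_eq_iff.1 h1 with ⟨h, -⟩ | ⟨h, -⟩
    · rcases (abs_eq zero_le_one).1 h with h' | h'
      · exact Or.inr (Or.inr ⟨h', h0, him.2⟩)
      · exact Or.inl ⟨h', h0, him.2⟩
    · rw [abs_of_nonneg h0] at h
      exact Or.inr (Or.inl ⟨h, hre.1, hre.2⟩)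
  · rintro (⟨h1, h2, h3⟩ | ⟨h1, h2, h3⟩ | ⟨h1, h2, h3⟩)
    · refine ⟨h2, ?_⟩
      rw [h1, abs_neg, abs_one, abs_of_nonneg h2]; exact max_eq_left h3
    · refine ⟨by linarith, ?_⟩
      rw [h1, abs_one]; exact max_eq_right (abs_le.2 ⟨h2, h3⟩)
    · refine ⟨h2, ?_⟩
      rw [h1, abs_one, abs_of_nonneg h2]; exact max_eq_left h3

/-- The outer half-square `{0 ≤ im, ‖·‖_∞ = L}` (`L > 0`) in linear coordinates. [folklore] -/
theorem mem_outer_iff {L : ℝ} (hL : 0 < L) {z : ℂ} : (0 ≤ z.im ∧ sn[z] = L) ↔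
    (z.re = L ∧ 0 ≤ z.im ∧ z.im ≤ L) ∨ (z.im = L ∧ -L ≤ z.re ∧ z.re ≤ L) ∨
      (z.re = -L ∧ 0 ≤ z.im ∧ z.im ≤ L) := by
  constructor
  · rintro ⟨h0, h1⟩
    have hre : |z.re| ≤ L := h1 ▸ le_max_left _ _
    have him : |z.im| ≤ L := h1 ▸ le_max_right _ _
    rw [abs_le] at hre him
    rcases max_eq_iff.1 h1 with ⟨h, -⟩ | ⟨h, -⟩
    · rcases (abs_eq hL.le).1 h with h' | h'
      · exact Or.inl ⟨h', h0, him.2⟩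
      · exact Or.inr (Or.inr ⟨h', h0, him.2⟩)
    · rw [abs_of_nonneg h0] at h
      exact Or.inr (Or.inl ⟨h, hre.1, hre.2⟩)
  · rintro (⟨h1, h2, h3⟩ | ⟨h1, h2, h3⟩ | ⟨h1, h2, h3⟩)
    · refine ⟨h2, ?_⟩
      rw [h1, abs_of_pos hL, abs_of_nonneg h2]; exact max_eq_left h3
    · refine ⟨by linarith, ?_⟩
      rw [h1, abs_of_pos hL]; exact max_eq_right (abs_le.2 ⟨h2, h3⟩)
    · refine ⟨h2, ?_⟩
      rw [h1, abs_neg, abs_of_pos hL, abs_of_nonneg h2]; exact max_eq_left h3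

/-! ### The open half-annulus is the inside of the octagon -/

/-- The open half-annulus is open. [folklore] -/
theorem isOpen_openHA (L : ℝ) : IsOpen openHA[L] := by
  have h : openHA[L] = ({z : ℂ | 0 < z.im} ∩ {z : ℂ | z.im < L} ∩ {z : ℂ | -L < z.re} ∩ {z : ℂ | z.re < L}) ∩
      ({z : ℂ | 1 < z.re} ∪ {z : ℂ | z.re < -1} ∪ {z : ℂ | 1 < z.im}) := by
    ext z; simp only [mem_inter_iff, mem_setOf_eq, mem_union]; tauto
  rw [h]
  exact ((((isOpen_lt continuous_const continuous_im).inter (isOpen_lt continuous_im continuous_const)).inter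
    (isOpen_lt continuous_const continuous_re)).inter (isOpen_lt continuous_re continuous_const)).inter
    (((isOpen_lt continuous_const continuous_re).union (isOpen_lt continuous_re continuous_const)).union
      (isOpen_lt continuous_const continuous_im))

/-- The closed half-annulus (linear form) is closed. [folklore] -/
theorem isClosed_closedHA (L : ℝ) : IsClosed closedHA[L] := by
  have h : closedHA[L] = ({z : ℂ | 0 ≤ z.im} ∩ {z : ℂ | z.im ≤ L} ∩ {z : ℂ | -L ≤ z.re} ∩ {z : ℂ | z.re ≤ L}) ∩
      ({z : ℂ | 1 ≤ z.re} ∪ {z : ℂ | z.re ≤ -1} ∪ {z : ℂ | 1 ≤ z.im}) := by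
    ext z; simp only [mem_inter_iff, mem_setOf_eq, mem_union]; tauto
  rw [h]
  exact ((((isClosed_le continuous_const continuous_im).inter (isClosed_le continuous_im continuous_const)).inter
    (isClosed_le continuous_const continuous_re)).inter (isClosed_le continuous_re continuous_const)).inter
    (((isClosed_le continuous_const continuous_re).union (isClosed_le continuous_re continuous_const)).union
      (isClosed_le continuous_const continuous_im))

/-- A point of the closed half-annulus off the open one lies on the octagon. [folklore] -/
theorem mem_range_of_mem_closedHA_diff {L : ℝ} (hL : 1 < L) {z : ℂ} (hz : z ∈ closedHA[L])
    (hz' : z ∉ openHA[L]) : z ∈ range (polygonLoop verts[L]) := by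
  rw [mem_range_polygonLoop_verts_iff hL]
  obtain ⟨h0, h1, h2, h3, h4⟩ := hz
  simp only [mem_setOf_eq, not_and_or, not_or, not_lt] at hz'
  rcases h0.eq_or_lt with h | h
  · -- `im z = 0`: bottom sides
    rcases h4 with h4 | h4 | h4
    · exact Or.inr (Or.inr (Or.inr (Or.inl ⟨h.symm, h4, h3⟩)))
    · exact Or.inr (Or.inr (Or.inr (Or.inr (Or.inr (Or.inr (Or.inr ⟨h.symm, h2, h4⟩))))))
    · exfalso; linarith
  rcases h1.eq_or_lt with k1 | k1
  · exact Or.inr (Or.inr (Or.inr (Or.inr (Or.inr (Or.inl ⟨k1, h2, h3⟩)))))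
  rcases h2.eq_or_lt with k2 | k2
  · exact Or.inr (Or.inr (Or.inr (Or.inr (Or.inr (Or.inr (Or.inl ⟨k2.symm, h0, h1⟩))))))
  rcases h3.eq_or_lt with k3 | k3
  · exact Or.inr (Or.inr (Or.inr (Or.inr (Or.inl ⟨k3, h0, h1⟩))))
  rcases hz' with hz' | hz' | hz' | hz' | ⟨hz1, hz2, hz3⟩
  · exfalso; linarith
  · exfalso; linarith
  · exfalso; linarith
  · exfalso; linarith
  rcases h4 with h4 | h4 | h4
  · exact Or.inr (Or.inr (Or.inl ⟨le_antisymm hz1 h4, h0, hz3⟩))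
  · exact Or.inl ⟨le_antisymm h4 hz2, h0, hz3⟩
  · exact Or.inr (Or.inl ⟨le_antisymm hz3 h4, hz2, hz1⟩)

/-- The octagon misses the open half-annulus. [folklore] -/
theorem not_mem_openHA_of_mem_range {L : ℝ} (hL : 1 < L) {z : ℂ}
    (hz : z ∈ range (polygonLoop verts[L])) : z ∉ openHA[L] := by
  rw [mem_range_polygonLoop_verts_iff hL] at hz
  rintro ⟨h0, h1, h2, h3, h4⟩
  rcases hz with ⟨a, b, c⟩ | ⟨a, b, c⟩ | ⟨a, b, c⟩ | ⟨a, b, c⟩ | ⟨a, b, c⟩ | ⟨a, b, c⟩ | ⟨a, b, c⟩ |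
    ⟨a, b, c⟩ <;> rcases h4 with h4 | h4 | h4 <;> linarith

/-- **The inside of the octagon is the open half-annulus.** [folklore] -/
theorem polygonDomain_verts_carrier {L : ℝ} (hL : 1 < L) :
    (polygonDomain verts[L] (isSimpleClosedPolygon_verts hL)).carrier = openHA[L] := by
  have hL0 : (0 : ℝ) < L := by linarith
  refine polygonDomain_carrier_eq _ _ (isOpen_openHA L) ?_ ?_ ?_ ?_
  · refine (Metric.isBounded_closedBall (x := (0 : ℂ)) (r := 2 * L)).subset fun z hz => ?_
    obtain ⟨h0, h1, h2, h3, -⟩ := hz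
    rw [Metric.mem_closedBall, dist_zero_right]
    refine (norm_le_abs_re_add_abs_im z).trans ?_
    have e1 := abs_le.2 (show -L ≤ z.im ∧ z.im ≤ L from ⟨by linarith, h1.le⟩)
    have e2 := abs_le.2 (show -L ≤ z.re ∧ z.re ≤ L from ⟨h2.le, h3.le⟩)
    linarith
  · refine ⟨⟨0, (1 + L) / 2⟩, ?_, ?_, ?_, ?_, Or.inr (Or.inr ?_)⟩ <;> dsimp only <;> linarith
  · intro z hz
    rw [(isOpen_openHA L).frontier_eq] at hz
    have hsub : openHA[L] ⊆ closedHA[L] := fun w hw => by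
      obtain ⟨h0, h1, h2, h3, h4⟩ := hw
      exact ⟨h0.le, h1.le, h2.le, h3.le, h4.imp le_of_lt (Or.imp le_of_lt le_of_lt)⟩
    exact mem_range_of_mem_closedHA_diff hL (closure_minimal hsub (isClosed_closedHA L) hz.1) hz.2
  · exact Set.disjoint_left.2 fun z hz hz' => not_mem_openHA_of_mem_range hL hz' hz

/-! ### The conformal rectangle -/

/-- **The half-annulus quad.** For every `L > 1` there is a conformal rectangle whose closed
carrier is the closed upper half-annulus `{0 ≤ im, 1 ≤ max |re| |im| ≤ L}` and whose sides
`0` and `2` are the inner and outer half-squares `{0 ≤ im, max |re| |im| = 1}`,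
`{0 ≤ im, max |re| |im| = L}` (the polygonal Jordan domain of the octagon
`-1, -1+i, 1+i, 1, L, L+Li, -L+Li, -L` with the corners `-1, 1, L, -L` marked).
[cite: SchrammSmirnov2011, §1.3 (quads)] -/
theorem exists_halfAnnulusQuad {L : ℝ} (hL : 1 < L) : ∃ R : ConformalRectangle,
    closure R.carrier = {z : ℂ | 0 ≤ z.im ∧ 1 ≤ sn[z] ∧ sn[z] ≤ L} ∧
      R.arc 0 = {z : ℂ | 0 ≤ z.im ∧ sn[z] = 1} ∧ R.arc 2 = {z : ℂ | 0 ≤ z.im ∧ sn[z] = L} := by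
  have hL0 : (0 : ℝ) < L := by linarith
  have hS := isSimpleClosedPolygon_verts hL
  let R : ConformalRectangle :=
    { toJordanDomain := polygonDomain verts[L] hS
      mark := ![0, 3 / 8, 1 / 2, 7 / 8]
      strictMono_mark := by
        refine Fin.strictMono_iff_lt_succ.2 fun k => ?_
        fin_cases k <;> simp <;> norm_num
      mark_mem := fun k => by fin_cases k <;> simp <;> norm_num }
  have hcar : R.carrier = openHA[L] := polygonDomain_verts_carrier hL
  have hfr : frontier R.carrier = range (polygonLoop verts[L]) := frontier_polygonDomain_eq_range _ hS
  -- the sides as images of parameter intervals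
  have himg : ∀ k : ℕ, (hk : k < 8) → polygonLoop verts[L] '' Icc ((k : ℝ) / 8) ((k + 1 : ℝ) / 8) =
      segment ℝ (verts[L][k]'(by simp; omega)) (verts[L][(k + 1) % 8]'(by simp; omega)) := fun k hk => by
    have := image_polygonLoop_Icc_div (l := verts[L]) (k := k) (by simp; omega)
    simpa using this
  have g0 := himg 0 (by norm_num)
  have g1 := himg 1 (by norm_num)
  have g2 := himg 2 (by norm_num)
  have g4 := himg 4 (by norm_num)
  have g5 := himg 5 (by norm_num)
  have g6 := himg 6 (by norm_num)
  norm_num at g0 g1 g2 g4 g5 g6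
  refine ⟨R, ?_, ?_, ?_⟩
  · -- closure of the carrier
    rw [closure_eq_self_union_frontier, hfr, hcar]
    ext z
    rw [mem_setOf_eq, mem_closedHA_iff]
    constructor
    · rintro (hz | hz)
      · obtain ⟨h0, h1, h2, h3, h4⟩ := hz
        exact ⟨h0.le, h1.le, h2.le, h3.le, h4.imp le_of_lt (Or.imp le_of_lt le_of_lt)⟩
      · rw [mem_range_polygonLoop_verts_iff hL] at hz
        rcases hz with ⟨a, b, c⟩ | ⟨a, b, c⟩ | ⟨a, b, c⟩ | ⟨a, b, c⟩ | ⟨a, b, c⟩ | ⟨a, b, c⟩ |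
          ⟨a, b, c⟩ | ⟨a, b, c⟩
        · exact ⟨b, by linarith, by linarith, by linarith, Or.inr (Or.inl a.le)⟩
        · exact ⟨by linarith, by linarith, by linarith, by linarith, Or.inr (Or.inr a.ge)⟩
        · exact ⟨b, by linarith, by linarith, by linarith, Or.inl a.ge⟩
        · exact ⟨a.ge, by linarith, by linarith, c, Or.inl b⟩
        · exact ⟨b, c, by linarith, a.le, Or.inl (by linarith)⟩
        · exact ⟨by linarith, a.le, b, c, Or.inr (Or.inr (by linarith))⟩
        · exact ⟨b, c, a.ge, by linarith, Or.inr (Or.inl (by linarith))⟩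
        · exact ⟨a.ge, by linarith, b, by linarith, Or.inr (Or.inl c)⟩
    · intro hz
      by_cases h : z ∈ openHA[L]
      · exact Or.inl h
      · exact Or.inr (mem_range_of_mem_closedHA_diff hL hz h)
  · -- side 0
    have e : R.arc 0 = polygonLoop verts[L] '' Icc (0 : ℝ) (3 / 8) := by
      show (polygonDomain verts[L] hS).boundary '' Icc (R.mark 0) (R.nextMark 0) = _
      rw [R.nextMark_of_lt 0 (by norm_num)]
      rfl
    have eI : Icc (0 : ℝ) (3 / 8) = Icc (0 : ℝ) (1 / 8) ∪ Icc (1 / 8) (1 / 4) ∪ Icc (1 / 4) (3 / 8) := by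
      rw [Icc_union_Icc_eq_Icc (by norm_num) (by norm_num), Icc_union_Icc_eq_Icc (by norm_num) (by norm_num)]
    rw [e, eI, image_union, image_union, g0, g1, g2]
    ext z
    rw [mem_setOf_eq, mem_inner_iff]
    simp only [mem_union, segment_vert (one_pos : (0 : ℝ) < 1), segment_horiz (show (-1 : ℝ) < 1 by norm_num),
      segment_symm ℝ (⟨1, 1⟩ : ℂ) ⟨1, 0⟩, mem_setOf_eq]
    tauto
  · -- side 2
    have e : R.arc 2 = polygonLoop verts[L] '' Icc (1 / 2 : ℝ) (7 / 8) := by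
      show (polygonDomain verts[L] hS).boundary '' Icc (R.mark 2) (R.nextMark 2) = _
      rw [R.nextMark_of_lt 2 (by norm_num)]
      rfl
    have eI : Icc (1 / 2 : ℝ) (7 / 8) = Icc (1 / 2 : ℝ) (5 / 8) ∪ Icc (5 / 8) (3 / 4) ∪ Icc (3 / 4) (7 / 8) := by
      rw [Icc_union_Icc_eq_Icc (by norm_num) (by norm_num), Icc_union_Icc_eq_Icc (by norm_num) (by norm_num)]
    rw [e, eI, image_union, image_union, g4, g5, g6]
    ext z
    rw [mem_setOf_eq, mem_outer_iff hL0]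
    simp only [mem_union, segment_vert hL0, segment_symm ℝ (⟨L, L⟩ : ℂ) ⟨-L, L⟩,
      segment_horiz (show -L < L by linarith), segment_symm ℝ (⟨-L, L⟩ : ℂ) ⟨-L, 0⟩, mem_setOf_eq]
    tauto

end HalfPlaneArm

end Literature.Probability.Percolation
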